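import Summits.NavierStokesRegularity.NavierStokesRegularity.Theorems.TypeIIInviscidRelaxationAxisymSwirlRegularTubeComparisonT
import Literature.Analysis.FluidPDE.Wei2016AprioriHolds
import HarnessLib

/-!
# One-sided radial-inflow criteria from TIME-DEPENDENT half-line barriers (ν = 1)

Helper toward the crux `AxisymSwirlRegular` (stmt-NavierStokesRegularity-1964, route TypeIIInviscidRelaxation),
registered line `radial_inflow_split`, criterion side `stub_oneSidedRadialCriterion` (⟨19059⟩): the open-slab
corollary of the time-dependent tube comparison `RadialInflowComparisonT.sign_mul_swirl_le_tube_t` and the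
continuation criterion it yields, GENERIC in the inflow envelope `E(r,t)`.

* `abs_swirl_le_of_timeDependentBarrier` — solutions on `[0,T)` (classical, axisymmetric slices, bounded on closed
  sub-slabs) obeying the gate `u_r ≥ −E(r,t)` on the unit tube `0 < r ≤ 1`, with swirl data `|Γ₀| ≤ L·min(r,1)²`,
  `|Γ| ≤ L`: for a barrier `w(r,t)` (jointly `C²` on `(0,2) × (0,T)`, continuous on `[0,2] × [0,T)`, `w(0,t) = 0`,
  nondecreasing in `r`, `w ≤ C r^α` on `[0,1]`, `w(1,t) ≥ 1`, `w(r,0) ≥ min(r,1)²`, supersolution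
  `w_rr − w_r/r + E·w_r ≤ w_t`) one has `|Γ(t,x)| ≤ L·w(r,t)` on `{r ≤ 1} × [0,T)`.  (The clause list is the
  ideator's `IsHalfLineBarrier` with the κ-envelope replaced by `E`; spelled out, no new definition.)
* `hasSmoothExtensionPast_of_timeDependentBarrier` — **the criterion**: in the standing class of ⟨19059⟩ at `ν = 1`
  (classical on `[0,T)`, Leray–Hopf on `[0,T]` from a rapidly decaying datum, bounded on closed sub-slabs,
  axisymmetric slices), the gate `u_r ≥ −E(r,t)` on `0 < r ≤ 1` plus ANY such barrier for `E` gives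
  `HasSmoothExtensionPast 1 0 u T`: the comparison yields the Hölder modulus `|Γ| ≤ L C r^α` at the axis, and
  Chen–Fang–Zhang's Remark 2 in its unconditional tree form (`ChenFangZhang2017.holderSwirl_regularity`, through
  Wei 2016) continues the solution.
* `hasSmoothExtensionPast_of_kappaEnvelope_nu_one` — the κ-inflow instance `E(r,t) = M r^{κ−1}(T−t)^{−κ/2}`:
  the ideator line `kappa-inflow` (ns-idea-4, crux workfile `KappaInflow_v1_9.lean`) is thereby IN THE TREE modulo
  its one open stub, the 1D barrier `HalfLineBarrierAt κ M T` (O1; explicit similarity profile O1a), for every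
  `κ` and `M` — at `κ = 1` a barrier would also discharge the named fact `Zhang2026_partialTypeI_regularity`
  (arXiv:2604.07785 Thm 1.1) on the unit tube.

Relation to the registered stub.  ⟨19059⟩ is the envelope `E = C/r` (κ = 0); there the tube-comparison method stops
at `C < 2` (`RadialInflowBarrierWall.exists_isTubeBarrier_iff_lt_two`), and time-dependence does not help at
`κ = 0` (the axis is polar for the Bessel(`C`) process, `C ≥ 2`).  The present criterion is the tree's interface for
every envelope that DOES admit a barrier; what it leaves to prove, per envelope, is one statement of real analysis
on `(0,2) × (0,T)`.

Ported (generic-`E` rewrite of `swirlComparison_holds`, `holderSwirl_of_comparison`, `extends_of_holderSwirl`) from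
the files-only κ-inflow skeleton `KappaInflow_v1_9.lean` of ns-idea-4 (2026-08-28).

References: Qi S. Zhang, arXiv:2604.07785 (2026), §3 [Zhang2026PartialTypeI]; H. Chen, D. Fang, T. Zhang,
DCDS 37 (2017), Remark 2 [ChenFangZhang2017]; D. Wei, J. Math. Anal. Appl. 435 (2016), Thm 1.1 [Wei2016].
-/

noncomputable section

set_option linter.dupNamespace false

open Literature.Analysis.FluidPDE MeasureTheory Set Filter Topology
open scoped ENNReal NNReal RealInnerProductSpace

namespace Summit.NavierStokesRegularity.NavierStokesRegularity.Theorems.RadialInflowComparisonT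

open Summit.NavierStokesRegularity.NavierStokesRegularity.Theorems
open Summit.NavierStokesRegularity.NavierStokesRegularity.Theorems.ScenarioCensus
open Summit.NavierStokesRegularity.NavierStokesRegularity.Theorems.ScenarioCensus.LogGate
open Metric Function InnerProductSpace

/-- **Open-slab tube comparison with a time-dependent barrier, generic envelope** (`ν = 1`). From
`sign_mul_swirl_le_tube_t` on every closed slab `[0,(t+T)/2]` (`IsClassicalNSSolutionOn.mono`, the sub-slab velocity
bound), both signs, `δ₀ = 1`, `A = L`, `wb = w`, `wbt = ∂ₜw`: the slab hypotheses are read off the barrier clauses —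
`C²` `r`-slices and the time derivative from the joint `C²` clause on `(0,2) × (0,T)`, joint continuity by restriction,
`w ≥ 0` and `∂ᵣw ≥ 0` from `w(0,t) = 0` + monotonicity (`MonotoneOn.derivWithin_nonneg`), the supersolution inequality,
the data `|Γ₀| ≤ L min(r,1)² ≤ L w(r,0)` and `|Γ| ≤ L ≤ L w(1,t)`. [cite: Zhang2026PartialTypeI, §3] -/
theorem abs_swirl_le_of_timeDependentBarrier {T L α C : ℝ} {E w : ℝ → ℝ → ℝ} {u : ℝ → E3 → E3}
    {p : ℝ → E3 → ℝ} (hT : 0 < T) (hL : 0 ≤ L)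
    (hC2j : ContDiffOn ℝ 2 (fun q : ℝ × ℝ => w q.1 q.2) (Ioo 0 2 ×ˢ Ioo 0 T))
    (hC0j : ContinuousOn (fun q : ℝ × ℝ => w q.1 q.2) (Icc 0 2 ×ˢ Ico 0 T))
    (hsl : ∀ t ∈ Ico 0 T, w 0 t = 0 ∧ MonotoneOn (fun r => w r t) (Icc 0 2) ∧
      (∀ r ∈ Icc (0 : ℝ) 1, w r t ≤ C * r ^ α) ∧ 1 ≤ w 1 t)
    (hdat0 : ∀ r ∈ Icc (0 : ℝ) 2, min r 1 ^ 2 ≤ w r 0)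
    (hpde : ∀ r ∈ Ioo (0 : ℝ) 2, ∀ t ∈ Ioo 0 T,
      iteratedDeriv 2 (fun ρ => w ρ t) r - r⁻¹ * deriv (fun ρ => w ρ t) r
          + E r t * deriv (fun ρ => w ρ t) r ≤ deriv (fun s => w r s) t)
    (hcl : IsClassicalNSSolutionOn (Ico 0 T) 1 0 u p)
    (hbdd : ∀ T' < T, ∃ B : ℝ, ∀ t ∈ Icc 0 T', ∀ x, ‖u t x‖ ≤ B)
    (hax : ∀ t ∈ Ico 0 T, IsAxisymmetric (u t))
    (henv : ∀ t ∈ Ico 0 T, ∀ x : E3, 0 < cylRadius x → cylRadius x ≤ 1 →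
      -E (cylRadius x) t ≤ radialVelocity (u t) x)
    (hdat : ∀ x, |swirl (u 0) x| ≤ L * min (cylRadius x) 1 ^ 2)
    (hglob : ∀ t ∈ Ico 0 T, ∀ x, |swirl (u t) x| ≤ L) :
    ∀ t ∈ Ico 0 T, ∀ x : E3, cylRadius x ≤ 1 → |swirl (u t) x| ≤ L * w (cylRadius x) t := by
  intro t ht x hx1
  -- restrict to the closed slab `[0, T']`, `T' = (t + T)/2`
  set T' : ℝ := (t + T) / 2 with hT'
  have hT'pos : 0 < T' := by rw [hT']; linarith [ht.1, ht.2]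
  have hT'T : T' < T := by rw [hT']; linarith [ht.2]
  have htT' : t ≤ T' := by rw [hT']; linarith [ht.2]
  have hsub : Icc 0 T' ⊆ Ico 0 T := fun s hs => ⟨hs.1, hs.2.trans_lt hT'T⟩
  have hsubo : Ioc 0 T' ⊆ Ioo 0 T := fun s hs => ⟨hs.1, hs.2.trans_lt hT'T⟩
  have hcl' : IsClassicalNSSolutionOn (Icc 0 T') 1 0 u p := hcl.mono hsub (uniqueDiffOn_Icc hT'pos)
  obtain ⟨V, hV⟩ := hbdd T' hT'T
  -- the barrier's slab facts, read off `IsHalfLineBarrier`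
  have hC2 : ∀ s ∈ Ioc 0 T', ContDiffOn ℝ 2 (fun ρ => w ρ s) (Ioo 0 2) := fun s hs => by
    have hm : ContDiff ℝ 2 (fun ρ : ℝ => (ρ, s)) := contDiff_id.prodMk contDiff_const
    exact hC2j.comp hm.contDiffOn fun ρ hρ => ⟨hρ, hsubo hs⟩
  have hC0 : ContinuousOn (fun q : ℝ × ℝ => w q.1 q.2) (Icc 0 1 ×ˢ Icc 0 T') :=
    hC0j.mono (prod_mono (Icc_subset_Icc_right one_le_two) hsub)
  have hwt : ∀ s ∈ Ioc 0 T', ∀ r ∈ Ioo (0 : ℝ) 1,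
      HasDerivAt (fun s' => w r s') (deriv (fun s' => w r s') s) s := by
    intro s hs r hr
    have hq : Ioo (0 : ℝ) 2 ×ˢ Ioo 0 T ∈ 𝓝 (r, s) :=
      (isOpen_Ioo.prod isOpen_Ioo).mem_nhds ⟨⟨hr.1, hr.2.trans one_lt_two⟩, hsubo hs⟩
    have hj : DifferentiableAt ℝ (fun q : ℝ × ℝ => w q.1 q.2) (r, s) :=
      (hC2j.contDiffAt hq).differentiableAt (by simp)
    have hm : DifferentiableAt ℝ (fun s' : ℝ => (r, s')) s :=
      (differentiableAt_const _).prodMk differentiableAt_id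
    have hd : DifferentiableAt ℝ (fun s' => w r s') s := hj.comp s hm
    exact hd.hasDerivAt
  have hwnn : ∀ s ∈ Icc 0 T', ∀ r ∈ Icc (0 : ℝ) 1, 0 ≤ w r s := by
    intro s hs r hr
    obtain ⟨h0, hmon, -, -⟩ := hsl s (hsub hs)
    have h := hmon ⟨le_rfl, zero_le_two⟩ ⟨hr.1, hr.2.trans one_le_two⟩ hr.1
    simpa [h0] using h
  have hmono : ∀ s ∈ Ioc 0 T', ∀ r ∈ Ioo (0 : ℝ) 1, 0 ≤ deriv (fun ρ => w ρ s) r := by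
    intro s hs r hr
    have hmon := (hsl s (hsub ⟨hs.1.le, hs.2⟩)).2.1
    rw [← derivWithin_of_mem_nhds (Icc_mem_nhds hr.1 (hr.2.trans one_lt_two))]
    exact hmon.derivWithin_nonneg
  have hop : ∀ s ∈ Ioc 0 T', ∀ r ∈ Ioo (0 : ℝ) 1,
      iteratedDeriv 2 (fun ρ => w ρ s) r - r⁻¹ * deriv (fun ρ => w ρ s) r
        + E r s * deriv (fun ρ => w ρ s) r ≤ deriv (fun s' => w r s') s :=
    fun s hs r hr => hpde r ⟨hr.1, hr.2.trans one_lt_two⟩ s (hsubo hs)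
  have hgate : ∀ s ∈ Icc 0 T', ∀ y : E3, 0 < cylRadius y → cylRadius y ≤ 1 →
      -(E (cylRadius y) s) ≤ radialVelocity (u s) y :=
    fun s hs y hy hy1 => henv s (hsub hs) y hy hy1
  have hdat' : ∀ y : E3, cylRadius y ≤ 1 → |swirl (u 0) y| ≤ L * w (cylRadius y) 0 := fun y hy => by
    have h1 := hdat y
    have h2 := hdat0 (cylRadius y) ⟨cylRadius_nonneg y, hy.trans one_le_two⟩
    have h3 := mul_le_mul_of_nonneg_left h2 hL
    linarith
  have hlatδ' : ∀ s ∈ Icc 0 T', ∀ y : E3, cylRadius y = 1 → |swirl (u s) y| ≤ L * w 1 s :=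
    fun s hs y _ => (hglob s (hsub hs) y).trans (le_mul_of_one_le_right hL (hsl s (hsub hs)).2.2.2)
  have key : ∀ σ : ℝ, (σ = 1 ∨ σ = -1) → σ * swirl (u t) x ≤ L * w (cylRadius x) t := fun σ hσ =>
    sign_mul_swirl_le_tube_t (E := E) (wb := w) (wbt := fun r s => deriv (fun s' => w r s') s)
      hT'pos hL one_le_two hcl' (fun s hs => hax s (hsub hs)) hV hC2 hC0 hwt hwnn hmono hop hgate hdat' hlatδ' hσ
      t ⟨ht.1, htT'⟩ x hx1
  have h1 := key 1 (Or.inl rfl)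
  have h2 := key (-1) (Or.inr rfl)
  rw [abs_le]
  constructor <;> linarith


/-- **The one-sided inflow criterion from a time-dependent half-line barrier** (`ν = 1`, generic envelope). In the
standing class of ⟨19059⟩ — classical on `[0,T)`, Leray–Hopf on `[0,T]` from a rapidly decaying datum, bounded on
closed sub-slabs, axisymmetric slices — the gate `u_r ≥ −E(r,t)` on the unit tube `0 < r ≤ 1` together with a
barrier `w` for `E` (clauses as in `abs_swirl_le_of_timeDependentBarrier`, `α > 0`) implies
`HasSmoothExtensionPast 1 0 u T`.  Proof: `swirl_data_bounds` gives `L`; the comparison gives `|Γ| ≤ L w ≤ L C r^α` on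
`r ≤ 1` and `|Γ| ≤ L ≤ L r^α` for `r ≥ 1`, so `|Γ| ≤ max (L C) L · r^α` everywhere, and
`ChenFangZhang2017.holderSwirl_regularity` (Remark 2 of Chen–Fang–Zhang 2017, unconditional in the tree via Wei 2016)
continues the solution. [cite: ChenFangZhang2017, Remark 2] -/
theorem hasSmoothExtensionPast_of_timeDependentBarrier {T α C : ℝ} {E w : ℝ → ℝ → ℝ} {u : ℝ → E3 → E3}
    {p : ℝ → E3 → ℝ} (hT : 0 < T) (hα : 0 < α)
    (hC2j : ContDiffOn ℝ 2 (fun q : ℝ × ℝ => w q.1 q.2) (Ioo 0 2 ×ˢ Ioo 0 T))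
    (hC0j : ContinuousOn (fun q : ℝ × ℝ => w q.1 q.2) (Icc 0 2 ×ˢ Ico 0 T))
    (hsl : ∀ t ∈ Ico 0 T, w 0 t = 0 ∧ MonotoneOn (fun r => w r t) (Icc 0 2) ∧
      (∀ r ∈ Icc (0 : ℝ) 1, w r t ≤ C * r ^ α) ∧ 1 ≤ w 1 t)
    (hdat0 : ∀ r ∈ Icc (0 : ℝ) 2, min r 1 ^ 2 ≤ w r 0)
    (hpde : ∀ r ∈ Ioo (0 : ℝ) 2, ∀ t ∈ Ioo 0 T,
      iteratedDeriv 2 (fun ρ => w ρ t) r - r⁻¹ * deriv (fun ρ => w ρ t) r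
          + E r t * deriv (fun ρ => w ρ t) r ≤ deriv (fun s => w r s) t)
    (hcl : IsClassicalNSSolutionOn (Ico 0 T) 1 0 u p) (hLH : IsLerayHopfOn T 1 0 (u 0) u)
    (hdec : HasRapidSpatialDecay (u 0))
    (hbdd : ∀ T' < T, ∃ B : ℝ, ∀ t ∈ Icc 0 T', ∀ x, ‖u t x‖ ≤ B)
    (hax : ∀ t ∈ Ico 0 T, IsAxisymmetric (u t))
    (henv : ∀ t ∈ Ico 0 T, ∀ x : E3, 0 < cylRadius x → cylRadius x ≤ 1 →
      -E (cylRadius x) t ≤ radialVelocity (u t) x) :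
    HasSmoothExtensionPast 1 0 u T := by
  obtain ⟨L, hL, hdat, hglob⟩ := swirl_data_bounds hT hcl hdec hbdd hax
  have hcmp := abs_swirl_le_of_timeDependentBarrier hT hL hC2j hC0j hsl hdat0 hpde hcl hbdd hax henv hdat hglob
  have hK : 0 ≤ max (L * C) L := hL.trans (le_max_right _ _)
  refine ChenFangZhang2017.holderSwirl_regularity hα hK hT hcl hLH hdec hax fun t ht x => ?_
  rcases le_or_gt (cylRadius x) 1 with hx1 | hx1
  · have hgrowth := (hsl t ht).2.2.1 (cylRadius x) ⟨cylRadius_nonneg x, hx1⟩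
    calc |swirl (u t) x| ≤ L * w (cylRadius x) t := hcmp t ht x hx1
      _ ≤ L * (C * cylRadius x ^ α) := mul_le_mul_of_nonneg_left hgrowth hL
      _ = L * C * cylRadius x ^ α := by ring
      _ ≤ max (L * C) L * cylRadius x ^ α :=
          mul_le_mul_of_nonneg_right (le_max_left _ _) (Real.rpow_nonneg (cylRadius_nonneg x) _)
  · have h1 : 1 ≤ cylRadius x ^ α := Real.one_le_rpow hx1.le hα.le
    calc |swirl (u t) x| ≤ L := hglob t ht x
      _ ≤ L * cylRadius x ^ α := le_mul_of_one_le_right hL h1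
      _ ≤ max (L * C) L * cylRadius x ^ α :=
          mul_le_mul_of_nonneg_right (le_max_right _ _) (Real.rpow_nonneg (cylRadius_nonneg x) _)

/-- **The κ-inflow criterion at `ν = 1`, modulo its 1D barrier** (ideator line `kappa-inflow`, ns-idea-4; its only
open stub is O1 `HalfLineBarrierAt κ M T`, spelled out here as the hypothesis `hB`). For ANY `κ, M` (the line takes
`0 < κ ≤ 1`, `M > 0`, but the implication needs neither): a solution of the standing class with
`u_r ≥ −M r^{κ−1}(T−t)^{−κ/2}` on the unit tube extends past `T` as soon as the half-line barrier for `(κ, M, T)`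
exists.  At `κ = 1` this is Q. S. Zhang's partial Type I theorem (arXiv:2604.07785 Thm 1.1, tree fact
`Zhang2026_partialTypeI_regularity`, `ν = 1`, gate on the unit tube) modulo the barrier; at `κ = 0` no barrier exists
for `M ≥ 2` (`RadialInflowBarrierWall.not_isTubeBarrier_of_two_le` for the time-independent ones). [new; conditional
on the barrier hypothesis `hB`] -/
theorem hasSmoothExtensionPast_of_kappaEnvelope_nu_one {κ M T : ℝ} {u : ℝ → E3 → E3} {p : ℝ → E3 → ℝ}
    (hT : 0 < T)
    (hB : ∃ (α C : ℝ) (w : ℝ → ℝ → ℝ), 0 < α ∧ α ≤ 1 ∧ 0 < C ∧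
      ContDiffOn ℝ 2 (fun q : ℝ × ℝ => w q.1 q.2) (Ioo 0 2 ×ˢ Ioo 0 T) ∧
      ContinuousOn (fun q : ℝ × ℝ => w q.1 q.2) (Icc 0 2 ×ˢ Ico 0 T) ∧
      (∀ t ∈ Ico 0 T, w 0 t = 0 ∧ MonotoneOn (fun r => w r t) (Icc 0 2) ∧
        (∀ r ∈ Icc (0 : ℝ) 1, w r t ≤ C * r ^ α) ∧ 1 ≤ w 1 t) ∧
      (∀ r ∈ Icc (0 : ℝ) 2, min r 1 ^ 2 ≤ w r 0) ∧
      (∀ r ∈ Ioo (0 : ℝ) 2, ∀ t ∈ Ioo 0 T,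
        iteratedDeriv 2 (fun ρ => w ρ t) r - r⁻¹ * deriv (fun ρ => w ρ t) r
            + M * r ^ (κ - 1) * (T - t) ^ (-(κ / 2)) * deriv (fun ρ => w ρ t) r
          ≤ deriv (fun s => w r s) t))
    (hcl : IsClassicalNSSolutionOn (Ico 0 T) 1 0 u p) (hLH : IsLerayHopfOn T 1 0 (u 0) u)
    (hdec : HasRapidSpatialDecay (u 0))
    (hbdd : ∀ T' < T, ∃ B : ℝ, ∀ t ∈ Icc 0 T', ∀ x, ‖u t x‖ ≤ B)
    (hax : ∀ t ∈ Ico 0 T, IsAxisymmetric (u t))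
    (henv : ∀ t ∈ Ico 0 T, ∀ x : E3, 0 < cylRadius x → cylRadius x ≤ 1 →
      -(M * cylRadius x ^ (κ - 1) * (T - t) ^ (-(κ / 2))) ≤ radialVelocity (u t) x) :
    HasSmoothExtensionPast 1 0 u T := by
  obtain ⟨α, C, w, hα, -, -, hC2j, hC0j, hsl, hdat0, hpde⟩ := hB
  exact hasSmoothExtensionPast_of_timeDependentBarrier
    (E := fun r t => M * r ^ (κ - 1) * (T - t) ^ (-(κ / 2))) hT hα hC2j hC0j hsl hdat0 hpde hcl hLH hdec
    hbdd hax henv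

end Summit.NavierStokesRegularity.NavierStokesRegularity.Theorems.RadialInflowComparisonT

end
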